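import Summits.QuantumFields.YangMills.Theorems.UnitScaleTiltHalvingP1FlatCoreTopLinearKnit
import HarnessLib

/-!
# Line H (`BirthV10.stub_halvingStep`, stmt-QuantumFields-19200), line H-P6J, LOCATE «J2′» §4 (i) — **THE LINEAR KNIT READ RIGHT-TO-LEFT**:
# the torus double-bar top variable `log U̿^{(k)}(W♭)(c♭)` is print's comb restriction functional `Q_k(1, iηA′)(c)` of [Balaban1985RegularSpaces] (1.42)
# up to the SAME two second-order remainders

Cell `ym3-torus` (HUMAN RULING D-0037: YM₃ on T³ is ladder rung R3, NOT the Clay problem), width seat `ym3-torus-px3` gen 4; LEAD-H ★w5-19200 g7 WORD 1 (D) line H-P6J,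
LOCATE `ym3-torus-px3/g4/LOCATE-J2PRIME-px3g4.md` §4 (i).  `--supports stmt-QuantumFields-19200 --as helper`; THEOREMS ONLY (0 `def`, 0 `sorry`); count-neutral; nothing here
claims `hSupU`, the near row (vi), the stub, the crux or the gap.

WHY.  ✓`P1FlatCoreTopLinearKnit.norm_logCovIter_one_le_of_remainders` (★w8-19936 g2) bounds the COMB functional by the TORUS double-bar datum: the H-γ lane supplies the torus side
(the (o)-bound of ✓`P1FlatCoreDP1TopBonds`) and consumes the comb side (hypothesis `H42` of lit's Prop. 3).  A junction with lit's unconditional Prop. 6 crown at the member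
(✓`HalvingP6JGaugedBoundAtMemberSU2`, conj. 11 = (1.137) «`Q_k(1, iηA) = log Ū₀′ᵏ` on `□^{(k)}`») runs the OTHER way: the crown supplies the comb side and the H door's (160)♭ near row
wants the torus side.  The two linear parts are the same number (✓`P1FlatCoreTopBondDictionary.linCovIter_one_eq_smul_bondAvgIter`), so the same two triangle inequalities give
the reverse bound with the same remainders `R₁` ([Balaban1985Averaging] Prop. 4, ✓`P1FlatCoreTopCombRemainderLoc`) and `R₂` (✓`Prop8ChartDoubleBar.norm_chartLogAt_sub_smul_bondAvgIter_le_of_reads`).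

WHAT IS PROVED (ns `…Theorems.P1FlatCoreTopLinearKnitRev`; letters VERBATIM those of ✓`P1FlatCoreTopLinearKnit`).
* §1 ★★ `norm_mlog_dbarIterU_le_of_remainders` — `‖log U̿^{(k)}(W♭)(c♭)‖ ≤ ‖Q_k(1, iηA′)(z,κ)‖ + R₁ + R₂` (abstract remainders).
* §2 ★★★ `norm_mlog_dbarIterU_le_norm_logCovIter_one` — at `Matrix n n ℂ`, (L1)∕(L2) by name: `… ≤ ‖Q_k(1, iηA′)(z,κ)‖ + (C₂(d) + 64·60800·((d+2)L)²)·(Lᵏηs)²`;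
  `…_of_socket` — the same in the socket letters `‖A♭‖ ≤ α₂·(Lᵏη)⁻¹` (remainder `(…)·α₂²`).
HONEST SCOPE.  Triangle inequalities over landed identities and the two landed remainder estimates; no new analysis.  The P6J near row needs, BEYOND this file, the size of the comb side
`‖log avgIter L (U′^{v}) k‖` (LOCATE §4 (ii)–(iv): p.98 axiality + the (43)∕ℰp comparison LEMMA B-al + `PlaqSmall ε₁ V`) — not here.

References: T. Bałaban, CMP **99** (1985) 75–102 [Balaban1985RegularSpaces] ((1.42) p.83, (1.137) p.99); CMP **98** (1985) 17–51 [Balaban1985Averaging] ((125)–(127) pp.36–37,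
Prop. 4 p.38); CMP **102** (1985) 277–309 [Balaban1985Variational] ((152)–(156) pp.301–302).
-/

set_option autoImplicit false

noncomputable section

open scoped BigOperators

namespace Summit.QuantumFields.YangMills.Theorems.P1FlatCoreTopLinearKnitRev

open Literature.MathematicalPhysics.QuantumFieldTheory.Balaban1983to89
open T4Continuum MatrixLog
open B15Eq112TorusCover (cover cover_apply)
open B14DomainGeom (Pt)
open Node00 (coverAt iterBlockOf_cover)
open LatticeFieldCalculus (bondAvgIter segSum)
open B5Eq118OneStroke (iterBlockOf bondAvgIter_eq_blockSum)
open B7Prop1Explicit (e e_apply)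
open B7Prop1Local (InBox AgreeOn loK bondHiK)
open B7Prop5Flat (BondIn)
open B7Prop4GeneralLevels (logCovIter linCovIter)
open B8Eq146AExpansion (iEta)
open B9Ineq3137LocalSup (linCovIter_congr)
open Summit.QuantumFields.YangMills.Theorems.Prop8Chart (expCfg)
open Summit.QuantumFields.YangMills.Theorems.Prop8ChartDoubleBar (dbarIterU dbarIterU_congr_of_agree)
open Summit.QuantumFields.YangMills.Theorems.P1FlatCoreTopBondDictionary (linCovIter_one_eq_smul_bondAvgIter)
open Summit.QuantumFields.YangMills.Theorems.P1FlatCoreTopLinearKnit (bondAvgIter_const_smul norm_iEta_le_of_junction)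

variable {P : Params}

/-! ## §1 The reverse knit with abstract remainders -/

section Knit

variable {𝔸 : Type*} [NormedRing 𝔸] [NormedAlgebra ℂ 𝔸] [CompleteSpace 𝔸] [NormOneClass 𝔸]

/-- ★★ **THE LINEAR KNIT, RIGHT-TO-LEFT.**  Fine torus with parameters `P`, top level `k ≤ m + K`, a top `ℤᵈ` bond `(z, κ)` and its torus image `c♭ = ⟨π_k z, κ⟩`;
`A′` agrees with `A♭∘π` on the comb box, `W♭ = e^{iηA♭}` on the read territory of `c♭`, `R₁` bounds the comb second-order remainder and `R₂` the torus one (as in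
✓`P1FlatCoreTopLinearKnit.norm_logCovIter_one_le_of_remainders`).  Then `‖log U̿^{(k)}(W♭)(c♭)‖ ≤ ‖Q_k(1, iηA′)(z,κ)‖ + R₁ + R₂`.
[cite: Balaban1985RegularSpaces, (1.42) p.83, (1.137) p.99; Balaban1985Averaging, (125)-(127) pp.36-37; Balaban1985Variational, (152)-(156) pp.301-302] -/
theorem norm_mlog_dbarIterU_le_of_remainders {k : ℕ} (hk : k ≤ P.m + P.K) (η : ℝ)
    (Af : PBond P 0 → 𝔸) (A' : Pt P.d → Fin P.d → 𝔸) (Wf : GaugeField P 0 𝔸ˣ) (z : Pt P.d) (κ : Fin P.d)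
    (hjunc : AgreeOn (loK P.L k z) (bondHiK P.L k z κ) A' (fun w μ => Af ⟨cover P w, μ⟩))
    (hW : ∀ b : PBond P 0,
      (iterBlockOf k b.src = (⟨coverAt P k z, κ⟩ : PBond P k).src ∨ iterBlockOf k b.src = (⟨coverAt P k z, κ⟩ : PBond P k).tgt) →
      (iterBlockOf k b.tgt = (⟨coverAt P k z, κ⟩ : PBond P k).src ∨ iterBlockOf k b.tgt = (⟨coverAt P k z, κ⟩ : PBond P k).tgt) →
        Wf b = expCfg η Af b)
    {R₁ R₂ : ℝ}
    (hrem₁ : ‖logCovIter P.L 1 (iEta η A') k z κ - linCovIter P.L 1 (iEta η A') k z κ‖ ≤ R₁)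
    (hrem₂ : ‖(-Complex.I) • mlog ((dbarIterU k (expCfg η Af) ⟨coverAt P k z, κ⟩ : 𝔸ˣ) : 𝔸)
        - ((η : ℂ) * (P.L : ℂ) ^ k) • bondAvgIter k Af ⟨coverAt P k z, κ⟩‖ ≤ R₂) :
    ‖mlog ((dbarIterU k Wf ⟨coverAt P k z, κ⟩ : 𝔸ˣ) : 𝔸)‖ ≤ ‖logCovIter P.L 1 (iEta η A') k z κ‖ + R₁ + R₂ := by
  have hL : 1 ≤ P.L := P.L_pos
  -- the globally periodic exponent field `B♯ = iη·(A♭∘π)`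
  set Bs : Pt P.d → Fin P.d → 𝔸 := fun w μ => ((Complex.I * (η : ℂ)) • Af) ⟨cover P w, μ⟩ with hBs
  have hagree : AgreeOn (loK P.L k z) (bondHiK P.L k z κ) (iEta η A') Bs := fun w μ hw hwe => by
    simp only [iEta, hBs, Pi.smul_apply]
    rw [hjunc w μ hw hwe]
  have hU : AgreeOn (loK P.L k z) (bondHiK P.L k z κ) (1 : Pt P.d → Fin P.d → 𝔸ˣ) 1 := fun _ _ _ _ => rfl
  have hcongr : linCovIter P.L 1 (iEta η A') k z κ = linCovIter P.L 1 Bs k z κ := linCovIter_congr P.L hL k z κ hU hagree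
  obtain ⟨b₀, hb₀⟩ := Finite.exists_le fun b : PBond P 0 => ‖((Complex.I * (η : ℂ)) • Af) b‖
  have hBs_le : ∀ w μ, ‖Bs w μ‖ ≤ max b₀ 0 := fun w μ => (hb₀ _).trans (le_max_left _ _)
  have hL3 := linCovIter_one_eq_smul_bondAvgIter hk ((Complex.I * (η : ℂ)) • Af) Bs (le_max_right b₀ 0) hBs_le
    (fun _ _ => rfl) z κ
  -- the two linear parts are the same number
  have hlin : linCovIter P.L 1 (iEta η A') k z κ =
      Complex.I • (((η : ℂ) * (P.L : ℂ) ^ k) • bondAvgIter k Af ⟨coverAt P k z, κ⟩) := by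
    rw [hcongr, hL3, bondAvgIter_const_smul hk, smul_smul, ← Complex.coe_smul, smul_smul]
    congr 1
    push_cast
    ring
  -- locality of the double-bar average
  have hloc : dbarIterU k Wf ⟨coverAt P k z, κ⟩ = dbarIterU k (expCfg η Af) ⟨coverAt P k z, κ⟩ :=
    dbarIterU_congr_of_agree k hk _ hW
  -- the norm of the common linear part, read from the comb side
  have hnlin : ‖linCovIter P.L 1 (iEta η A') k z κ‖ = ‖((η : ℂ) * (P.L : ℂ) ^ k) • bondAvgIter k Af ⟨coverAt P k z, κ⟩‖ := by
    rw [hlin, norm_smul Complex.I, Complex.norm_I, one_mul]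
  -- assemble the two triangle inequalities
  have h1 : ‖linCovIter P.L 1 (iEta η A') k z κ‖ ≤ ‖logCovIter P.L 1 (iEta η A') k z κ‖ + R₁ := by
    have h := norm_le_insert' (linCovIter P.L 1 (iEta η A') k z κ) (logCovIter P.L 1 (iEta η A') k z κ)
    rw [norm_sub_rev] at hrem₁
    linarith
  have h2 : ‖mlog ((dbarIterU k Wf ⟨coverAt P k z, κ⟩ : 𝔸ˣ) : 𝔸)‖ ≤ ‖linCovIter P.L 1 (iEta η A') k z κ‖ + R₂ := by
    rw [hloc, hnlin]
    have hI : ‖mlog ((dbarIterU k (expCfg η Af) ⟨coverAt P k z, κ⟩ : 𝔸ˣ) : 𝔸)‖ =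
        ‖(-Complex.I) • mlog ((dbarIterU k (expCfg η Af) ⟨coverAt P k z, κ⟩ : 𝔸ˣ) : 𝔸)‖ := by
      rw [norm_smul, norm_neg, Complex.norm_I, one_mul]
    rw [hI]
    have h := norm_le_insert' ((-Complex.I) • mlog ((dbarIterU k (expCfg η Af) ⟨coverAt P k z, κ⟩ : 𝔸ˣ) : 𝔸))
      (((η : ℂ) * (P.L : ℂ) ^ k) • bondAvgIter k Af ⟨coverAt P k z, κ⟩)
    linarith [hrem₂]
  linarith [h1, h2]

end Knit

/-! ## §2 The assembled bound at `Matrix n n ℂ`: rows (L1), (L2) by name -/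

section Assembly

open scoped Matrix.Norms.L2Operator
open B7Prop4Flat (C2 c4)
open Summit.QuantumFields.YangMills.Theorems.P1FlatCoreTopCombRemainderLoc (norm_logCovIter_sub_linCovIter_le_loc)
open Summit.QuantumFields.YangMills.Theorems.Prop8ChartDoubleBar (norm_chartLogAt_sub_smul_bondAvgIter_le_of_reads)

variable {n : Type*} [Fintype n] [DecidableEq n] [Nonempty n]

/-- ★★★ **THE REVERSE LINEAR ROUTE, ASSEMBLED.**  Fine torus with parameters `P` (`2 ≤ L`), top level `1 ≤ k ≤ m + K`, `η > 0`, matrices `M_n(ℂ)` in the operator norm.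
If `A′` agrees with `A♭∘π` on the comb box of the top bond `(z, κ)`, `W♭ = e^{iηA♭}` on the read territory of `c♭ = ⟨π_k z, κ⟩`, and `‖A♭‖ ≤ s` there with `Lᵏηs ≤ c₄(d)` and
`243200((d+2)L)²·Lᵏηs ≤ 1`, then `‖log U̿^{(k)}(W♭)(c♭)‖ ≤ ‖Q_k(1, iηA′)(z,κ)‖ + (C₂(d) + 64·60800·((d+2)L)²)·(Lᵏηs)²` — §1 with `R₁` from
✓`norm_logCovIter_sub_linCovIter_le_loc` and `R₂` from ✓`norm_chartLogAt_sub_smul_bondAvgIter_le_of_reads`.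
[cite: Balaban1985RegularSpaces, (1.42) p.83, (1.137) p.99; Balaban1985Averaging, Prop. 4 (134)-(135) pp.38-39; Balaban1985Variational, (152)-(156) pp.301-302] -/
theorem norm_mlog_dbarIterU_le_norm_logCovIter_one (hL : 2 ≤ P.L) {k : ℕ} (hk1 : 1 ≤ k) (hk : k ≤ P.m + P.K) {η : ℝ} (hη : 0 < η)
    (Af : PBond P 0 → Matrix n n ℂ) (A' : Pt P.d → Fin P.d → Matrix n n ℂ) (Wf : GaugeField P 0 (Matrix n n ℂ)ˣ)
    (z : Pt P.d) (κ : Fin P.d) (hjunc : AgreeOn (loK P.L k z) (bondHiK P.L k z κ) A' (fun w μ => Af ⟨cover P w, μ⟩))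
    (hW : ∀ b : PBond P 0,
      (iterBlockOf k b.src = (⟨coverAt P k z, κ⟩ : PBond P k).src ∨ iterBlockOf k b.src = (⟨coverAt P k z, κ⟩ : PBond P k).tgt) →
      (iterBlockOf k b.tgt = (⟨coverAt P k z, κ⟩ : PBond P k).src ∨ iterBlockOf k b.tgt = (⟨coverAt P k z, κ⟩ : PBond P k).tgt) →
        Wf b = expCfg η Af b)
    {s : ℝ} (hs0 : 0 ≤ s)
    (hA : ∀ b : PBond P 0,
      (iterBlockOf k b.src = (⟨coverAt P k z, κ⟩ : PBond P k).src ∨ iterBlockOf k b.src = (⟨coverAt P k z, κ⟩ : PBond P k).tgt) →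
      (iterBlockOf k b.tgt = (⟨coverAt P k z, κ⟩ : PBond P k).src ∨ iterBlockOf k b.tgt = (⟨coverAt P k z, κ⟩ : PBond P k).tgt) →
        ‖Af b‖ ≤ s)
    (hkb : (P.L : ℝ) ^ k * (η * s) ≤ c4 P.d)
    (hbudget : 243200 * (((P.d + 2) * P.L : ℕ) : ℝ) ^ 2 * (P.L : ℝ) ^ k * η * s ≤ 1) :
    ‖mlog ((dbarIterU k Wf ⟨coverAt P k z, κ⟩ : (Matrix n n ℂ)ˣ) : Matrix n n ℂ)‖ ≤
      ‖logCovIter P.L 1 (iEta η A') k z κ‖ +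
        (C2 P.d + 64 * 60800 * (((P.d + 2) * P.L : ℕ) : ℝ) ^ 2) * ((P.L : ℝ) ^ k * η * s) ^ 2 := by
  have hB := norm_iEta_le_of_junction hk hη.le Af A' z κ hjunc hA
  have h1 := (norm_logCovIter_sub_linCovIter_le_loc P.L hL k hk1 z κ (iEta η A') (by positivity : (0 : ℝ) ≤ η * s) hB hkb).1
  have h2 := norm_chartLogAt_sub_smul_bondAvgIter_le_of_reads η hη hk (⟨coverAt P k z, κ⟩ : PBond P k) Af hs0 hbudget hA
  have h := norm_mlog_dbarIterU_le_of_remainders hk η Af A' Wf z κ hjunc hW h1 h2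
  have e : (P.L : ℝ) ^ k * (η * s) = (P.L : ℝ) ^ k * η * s := by ring
  rw [e] at h
  linarith

/-- ★★ **THE SAME IN THE SOCKET LETTERS** `‖A♭(b)‖ ≤ α₂·(Lᵏη)⁻¹` (then `Lᵏηs = α₂`): `‖log U̿^{(k)}(W♭)(c♭)‖ ≤ ‖Q_k(1, iηA′)(z,κ)‖ + (C₂(d) + 64·60800·((d+2)L)²)·α₂²`
under `α₂ ≤ c₄(d)`, `243200((d+2)L)²α₂ ≤ 1`.
[cite: Balaban1985RegularSpaces, (1.42) p.83, (1.34)-(1.35) p.82, (1.137) p.99; Balaban1985Averaging, Prop. 4 pp.38-39; Balaban1985Variational, (152)-(156) pp.301-302] -/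
theorem norm_mlog_dbarIterU_le_norm_logCovIter_one_of_socket (hL : 2 ≤ P.L) {k : ℕ} (hk1 : 1 ≤ k) (hk : k ≤ P.m + P.K) {η : ℝ} (hη : 0 < η)
    (Af : PBond P 0 → Matrix n n ℂ) (A' : Pt P.d → Fin P.d → Matrix n n ℂ) (Wf : GaugeField P 0 (Matrix n n ℂ)ˣ)
    (z : Pt P.d) (κ : Fin P.d) (hjunc : AgreeOn (loK P.L k z) (bondHiK P.L k z κ) A' (fun w μ => Af ⟨cover P w, μ⟩))
    (hW : ∀ b : PBond P 0,
      (iterBlockOf k b.src = (⟨coverAt P k z, κ⟩ : PBond P k).src ∨ iterBlockOf k b.src = (⟨coverAt P k z, κ⟩ : PBond P k).tgt) →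
      (iterBlockOf k b.tgt = (⟨coverAt P k z, κ⟩ : PBond P k).src ∨ iterBlockOf k b.tgt = (⟨coverAt P k z, κ⟩ : PBond P k).tgt) →
        Wf b = expCfg η Af b)
    {α₂ : ℝ} (hα₂ : 0 ≤ α₂)
    (hA : ∀ b : PBond P 0,
      (iterBlockOf k b.src = (⟨coverAt P k z, κ⟩ : PBond P k).src ∨ iterBlockOf k b.src = (⟨coverAt P k z, κ⟩ : PBond P k).tgt) →
      (iterBlockOf k b.tgt = (⟨coverAt P k z, κ⟩ : PBond P k).src ∨ iterBlockOf k b.tgt = (⟨coverAt P k z, κ⟩ : PBond P k).tgt) →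
        ‖Af b‖ ≤ α₂ * ((P.L : ℝ) ^ k * η)⁻¹)
    (hkb : α₂ ≤ c4 P.d) (hbudget : 243200 * (((P.d + 2) * P.L : ℕ) : ℝ) ^ 2 * α₂ ≤ 1) :
    ‖mlog ((dbarIterU k Wf ⟨coverAt P k z, κ⟩ : (Matrix n n ℂ)ˣ) : Matrix n n ℂ)‖ ≤
      ‖logCovIter P.L 1 (iEta η A') k z κ‖ + (C2 P.d + 64 * 60800 * (((P.d + 2) * P.L : ℕ) : ℝ) ^ 2) * α₂ ^ 2 := by
  have hL0 : (0 : ℝ) < (P.L : ℝ) ^ k * η := by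
    have : (0 : ℝ) < P.L := by exact_mod_cast P.L_pos
    positivity
  have e : (P.L : ℝ) ^ k * η * (α₂ * ((P.L : ℝ) ^ k * η)⁻¹) = α₂ := by field_simp
  have hs0 : 0 ≤ α₂ * ((P.L : ℝ) ^ k * η)⁻¹ := mul_nonneg hα₂ (inv_nonneg.mpr hL0.le)
  have hkb' : (P.L : ℝ) ^ k * (η * (α₂ * ((P.L : ℝ) ^ k * η)⁻¹)) ≤ c4 P.d := by rwa [← mul_assoc, e]
  have hbudget' : 243200 * (((P.d + 2) * P.L : ℕ) : ℝ) ^ 2 * (P.L : ℝ) ^ k * η * (α₂ * ((P.L : ℝ) ^ k * η)⁻¹) ≤ 1 := by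
    have h' : 243200 * (((P.d + 2) * P.L : ℕ) : ℝ) ^ 2 * (P.L : ℝ) ^ k * η * (α₂ * ((P.L : ℝ) ^ k * η)⁻¹) =
        243200 * (((P.d + 2) * P.L : ℕ) : ℝ) ^ 2 * ((P.L : ℝ) ^ k * η * (α₂ * ((P.L : ℝ) ^ k * η)⁻¹)) := by ring
    rw [h', e]
    exact hbudget
  have h := norm_mlog_dbarIterU_le_norm_logCovIter_one hL hk1 hk hη Af A' Wf z κ hjunc hW hs0 hA hkb' hbudget'
  rwa [e] at h

end Assembly

end Summit.QuantumFields.YangMills.Theorems.P1FlatCoreTopLinearKnitRev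

end
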